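import Summits.ABC.ABC.Theses.TwoSixPencil
import Literature.NumberTheory.EllipticCurves.IntegralModelMinimalScalingProofs
import Literature.NumberTheory.EllipticCurves.SzpiroFreyProofs
import Literature.NumberTheory.DiophantineGeometry.MinimalDiscriminantFactorizationProofs
import Literature.NumberTheory.DiophantineGeometry.ConductorFactorizationProofs
import HarnessLib

/-!
# The ℤ/2×ℤ/6 dictionary: Tate's algorithm away from `6` on Kubert's model `W(u, w)`

`Summits/ABC/ABC/Theorems/TwoSixPencilTwoSixDictionary.lean` — closes the support item
stmt-ABC-24784 `Summit.ABC.ABC.Theses.TwoSixPencil.TwoSixDictionary` of route `TwoSixPencil`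
(abc-idea-1 g4, LINE g4-2), on the pattern of `sixTorsionDictionary_proof`
(file `RationalCuspPencilSixTorsionDictionary.lean`) and `twoTorsionDictionary_proof`.

**Statement.** For coprime integers `u, w` with `F(u,w) = w(u−w)(u−3w)(u+3w)(u−5w)(u−9w) ≠ 0` and
every elliptic `W = ⟨u²+2uw−19w², 2w(u−5w)(u−w)², 2w(u−5w)(u−w)²(u−3w)(u+3w), 0, 0⟩ / ℚ`
(Kubert's Tate normal form of a curve with torsion ⊇ ℤ/2×ℤ/6):

* `|Δ_min(W)| ≤ |64 w⁶(u−w)⁶(u−3w)²(u+3w)²(u−5w)⁶(u−9w)²|` — the right-hand side is `|Δ|` of the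
  integral equation (`Δ_eq`, a polynomial identity), and `Δ_min ∣ Δ(W₀)` prime by prime
  [Silverman AEC VII.1 Remark 1.1];
* `rad F ∣ 6 · N_W` — for a prime `p ≥ 5` dividing a cusp form `L ∈ {w, u−w, u−3w, u+3w, u−5w, u−9w}`:
  `c₄ = u⁸−24u⁷w+204u⁶w²−648u⁵w³−330u⁴w⁴+6552u³w⁵+2604u²w⁶−86904uw⁷+144081w⁸ = L·q_L + r_L`
  with `r_w = u⁸` and `r_{u−cw} = ρ_c·w⁸`, `ρ₁ = ρ₅ = 2¹⁶`, `ρ₃ = 2⁸3²`, `ρ₋₃ = ρ₉ = 2¹⁶3²` (explicit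
  degree-7 quotients below), so `p ∣ c₄` would force `p ∣ w` and `p ∣ u`; hence `p ∤ c₄`, the equation
  is minimal at `p` with multiplicative reduction, `f_p = 1`, `p ∣ N_W` (Tate's algorithm,
  Silverman AEC VII.5.1(b); tree `WeierstrassCurve.conductorExponent_eq_one_of_dvd_Δ_of_not_dvd_c₄`);
  `2, 3` are absorbed by the factor `6`.

HONESTY. Local bookkeeping on the ℤ/2×ℤ/6 class; it moves no rung of LADDER-ABC; the class ε-shape
it serves (exponent `1/6`) is NOT abc, NOT A-PS (polynomial Szpiro), NOT A1′; abc distance = the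
route's declared residual. References: [SilvermanAEC2009] VII.1 Remark 1.1, VII.5 Prop. 5.1(b);
[Kubert1976] Table 3.
-/

set_option linter.dupNamespace false

namespace Summit.ABC.ABC.Theorems

open IsDedekindDomain WeierstrassCurve Rat.HeightOneSpectrum UniqueFactorizationMonoid
open Literature.NumberTheory.EllipticCurves Literature.NumberTheory.DiophantineGeometry

namespace TwoSixDictionary

/-! ### The integral Kubert equation -/

/-- `c₄` of Kubert's ℤ/2×ℤ/6 model. [cite: Kubert1976, Table 3] -/
theorem c₄_eq (u w : ℤ) :
    (⟨u ^ 2 + 2 * u * w - 19 * w ^ 2, 2 * w * (u - 5 * w) * (u - w) ^ 2,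
        2 * w * (u - 5 * w) * (u - w) ^ 2 * (u - 3 * w) * (u + 3 * w), 0, 0⟩ : WeierstrassCurve ℤ).c₄ =
      u ^ 8 - 24 * u ^ 7 * w + 204 * u ^ 6 * w ^ 2 - 648 * u ^ 5 * w ^ 3 - 330 * u ^ 4 * w ^ 4 +
        6552 * u ^ 3 * w ^ 5 + 2604 * u ^ 2 * w ^ 6 - 86904 * u * w ^ 7 + 144081 * w ^ 8 := by
  simp only [WeierstrassCurve.c₄, WeierstrassCurve.b₂, WeierstrassCurve.b₄]
  ring

/-- `Δ = 64 w⁶(u−w)⁶(u−3w)²(u+3w)²(u−5w)⁶(u−9w)²` for Kubert's ℤ/2×ℤ/6 model (dictionary item (D1);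
PARI check job j296935). [cite: Kubert1976, Table 3] -/
theorem Δ_eq (u w : ℤ) :
    (⟨u ^ 2 + 2 * u * w - 19 * w ^ 2, 2 * w * (u - 5 * w) * (u - w) ^ 2,
        2 * w * (u - 5 * w) * (u - w) ^ 2 * (u - 3 * w) * (u + 3 * w), 0, 0⟩ : WeierstrassCurve ℤ).Δ =
      64 * (w ^ 6 * (u - w) ^ 6 * (u - 3 * w) ^ 2 * (u + 3 * w) ^ 2 * (u - 5 * w) ^ 6 *
        (u - 9 * w) ^ 2) := by
  simp only [WeierstrassCurve.Δ, WeierstrassCurve.b₂, WeierstrassCurve.b₄, WeierstrassCurve.b₆,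
    WeierstrassCurve.b₈]
  ring

/-- The integral Kubert equation base-changed to `ℚ` is the route's `W(u, w) / ℚ`. [folklore] -/
theorem baseChange_eq (u w : ℤ) :
    (⟨u ^ 2 + 2 * u * w - 19 * w ^ 2, 2 * w * (u - 5 * w) * (u - w) ^ 2,
        2 * w * (u - 5 * w) * (u - w) ^ 2 * (u - 3 * w) * (u + 3 * w), 0, 0⟩ :
        WeierstrassCurve ℤ).baseChange ℚ =
      ⟨((u ^ 2 + 2 * u * w - 19 * w ^ 2 : ℤ) : ℚ), ((2 * w * (u - 5 * w) * (u - w) ^ 2 : ℤ) : ℚ),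
        ((2 * w * (u - 5 * w) * (u - w) ^ 2 * (u - 3 * w) * (u + 3 * w) : ℤ) : ℚ), 0, 0⟩ := by
  ext <;> simp [WeierstrassCurve.baseChange, WeierstrassCurve.map]

/-! ### Primes `p ≥ 5` of the six cusp forms do not divide `c₄` -/

/-- A prime `p ≥ 5` does not divide `589824 = 2¹⁶·3²`. [folklore] -/
theorem not_dvd_589824 {p : ℕ} (hp : p.Prime) (h5 : 5 ≤ p) : ¬ (p : ℤ) ∣ 589824 := by
  intro h
  have h' : p ∣ 2 ^ 16 * 3 ^ 2 := by exact_mod_cast h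
  rcases (Nat.Prime.dvd_mul hp).mp h' with h2 | h3
  · have := (Nat.prime_dvd_prime_iff_eq hp Nat.prime_two).mp (hp.dvd_of_dvd_pow h2); omega
  · have := (Nat.prime_dvd_prime_iff_eq hp Nat.prime_three).mp (hp.dvd_of_dvd_pow h3); omega

/-- The linear-form step: if `p ≥ 5` divides `u − c w` and `P = (u − cw)·q + ρ·w⁸` with
`ρ ∣ 2¹⁶3²`, then `p ∣ P` forces `p ∣ w` and `p ∣ u`, impossible for coprime `u, w`. [folklore] -/
theorem key_lin {u w : ℤ} (huw : IsCoprime u w) {p : ℕ} (hp : p.Prime) (h5 : 5 ≤ p)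
    {c q ρ P : ℤ} (hL : (p : ℤ) ∣ u - c * w) (hP : P = (u - c * w) * q + ρ * w ^ 8)
    (hρ : ρ ∣ 589824) (hc : (p : ℤ) ∣ P) : False := by
  have hpint : Prime (p : ℤ) := Nat.prime_iff_prime_int.mp hp
  have h1 : (p : ℤ) ∣ ρ * w ^ 8 := by
    have := dvd_sub hc (dvd_mul_of_dvd_left hL q)
    rwa [hP, add_sub_cancel_left] at this
  have hw : (p : ℤ) ∣ w := by
    rcases hpint.dvd_or_dvd h1 with h2 | h2
    · exact absurd (h2.trans hρ) (not_dvd_589824 hp h5)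
    · exact hpint.dvd_of_dvd_pow h2
  have hu : (p : ℤ) ∣ u := by
    have := dvd_add hL (dvd_mul_of_dvd_right hw c)
    rwa [sub_add_cancel] at this
  exact hpint.not_unit (huw.isUnit_of_dvd' hu hw)

/-- For coprime `u, w` and a prime `p ≥ 5` dividing `F(u,w) = w(u−w)(u−3w)(u+3w)(u−5w)(u−9w)`:
`p ∤ c₄` (division of `c₄` by each cusp form with remainder `u⁸` resp. `2^a3^b·w⁸`). [folklore] -/
theorem not_dvd_c₄ {u w : ℤ} (huw : IsCoprime u w) {p : ℕ} (hp : p.Prime) (h5 : 5 ≤ p)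
    (h : (p : ℤ) ∣ w * (u - w) * (u - 3 * w) * (u + 3 * w) * (u - 5 * w) * (u - 9 * w)) :
    ¬ (p : ℤ) ∣ (⟨u ^ 2 + 2 * u * w - 19 * w ^ 2, 2 * w * (u - 5 * w) * (u - w) ^ 2,
        2 * w * (u - 5 * w) * (u - w) ^ 2 * (u - 3 * w) * (u + 3 * w), 0, 0⟩ : WeierstrassCurve ℤ).c₄ := by
  rw [c₄_eq]
  set P : ℤ := u ^ 8 - 24 * u ^ 7 * w + 204 * u ^ 6 * w ^ 2 - 648 * u ^ 5 * w ^ 3 -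
    330 * u ^ 4 * w ^ 4 + 6552 * u ^ 3 * w ^ 5 + 2604 * u ^ 2 * w ^ 6 - 86904 * u * w ^ 7 +
    144081 * w ^ 8 with hPdef
  intro hc
  have hpint : Prime (p : ℤ) := Nat.prime_iff_prime_int.mp hp
  rcases hpint.dvd_or_dvd h with h₁ | h9
  · rcases hpint.dvd_or_dvd h₁ with h₂ | h5'
    · rcases hpint.dvd_or_dvd h₂ with h₃ | hm3
      · rcases hpint.dvd_or_dvd h₃ with h₄ | h3'
        · rcases hpint.dvd_or_dvd h₄ with hw | h1'
          · -- `p ∣ w`: `c₄ = w·q + u⁸`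
            have hq : P = w * (-24 * u ^ 7 + 204 * u ^ 6 * w - 648 * u ^ 5 * w ^ 2 - 330 * u ^ 4 * w ^ 3 +
                6552 * u ^ 3 * w ^ 4 + 2604 * u ^ 2 * w ^ 5 - 86904 * u * w ^ 6 + 144081 * w ^ 7) +
                u ^ 8 := by rw [hPdef]; ring
            have h2 : (p : ℤ) ∣ w * (-24 * u ^ 7 + 204 * u ^ 6 * w - 648 * u ^ 5 * w ^ 2 -
                330 * u ^ 4 * w ^ 3 + 6552 * u ^ 3 * w ^ 4 + 2604 * u ^ 2 * w ^ 5 - 86904 * u * w ^ 6 +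
                144081 * w ^ 7) := dvd_mul_of_dvd_left hw _
            have h1 : (p : ℤ) ∣ u ^ 8 := by
              have := dvd_sub hc h2
              rwa [hq, add_sub_cancel_left] at this
            exact hpint.not_unit (huw.isUnit_of_dvd' (hpint.dvd_of_dvd_pow h1) hw)
          · -- `p ∣ u − w`
            refine key_lin huw hp h5 (c := 1) (by simpa using h1') (q := u ^ 7 - 23 * u ^ 6 * w +
              181 * u ^ 5 * w ^ 2 - 467 * u ^ 4 * w ^ 3 - 797 * u ^ 3 * w ^ 4 + 5755 * u ^ 2 * w ^ 5 +
              8359 * u * w ^ 6 - 78545 * w ^ 7) (ρ := 65536) ?_ ⟨9, by norm_num⟩ hc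
            rw [hPdef]; ring
        · -- `p ∣ u − 3w`
          refine key_lin huw hp h5 (c := 3) h3' (q := u ^ 7 - 21 * u ^ 6 * w + 141 * u ^ 5 * w ^ 2 -
            225 * u ^ 4 * w ^ 3 - 1005 * u ^ 3 * w ^ 4 + 3537 * u ^ 2 * w ^ 5 + 13215 * u * w ^ 6 -
            47259 * w ^ 7) (ρ := 2304) ?_ ⟨256, by norm_num⟩ hc
          rw [hPdef]; ring
      · -- `p ∣ u + 3w`
        refine key_lin huw hp h5 (c := -3) (by simpa [sub_neg_eq_add, neg_mul] using hm3)
          (q := u ^ 7 - 27 * u ^ 6 * w + 285 * u ^ 5 * w ^ 2 - 1503 * u ^ 4 * w ^ 3 +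
            4179 * u ^ 3 * w ^ 4 - 5985 * u ^ 2 * w ^ 5 + 20559 * u * w ^ 6 - 148581 * w ^ 7)
          (ρ := 589824) ?_ dvd_rfl hc
        rw [hPdef]; ring
    · -- `p ∣ u − 5w`
      refine key_lin huw hp h5 (c := 5) h5' (q := u ^ 7 - 19 * u ^ 6 * w + 109 * u ^ 5 * w ^ 2 -
        103 * u ^ 4 * w ^ 3 - 845 * u ^ 3 * w ^ 4 + 2327 * u ^ 2 * w ^ 5 + 14239 * u * w ^ 6 -
        15709 * w ^ 7) (ρ := 65536) ?_ ⟨9, by norm_num⟩ hc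
      rw [hPdef]; ring
  · -- `p ∣ u − 9w`
    refine key_lin huw hp h5 (c := 9) h9 (q := u ^ 7 - 15 * u ^ 6 * w + 69 * u ^ 5 * w ^ 2 -
      27 * u ^ 4 * w ^ 3 - 573 * u ^ 3 * w ^ 4 + 1395 * u ^ 2 * w ^ 5 + 15159 * u * w ^ 6 +
      49527 * w ^ 7) (ρ := 589824) ?_ dvd_rfl hc
    rw [hPdef]; ring

/-- **Tate's algorithm away from `6` on the Kubert ℤ/2×ℤ/6 model** (Silverman AEC VII.5.1(b)): for
coprime `u, w` with the integral equation elliptic over `ℚ` and a prime `p ≥ 5` dividing `F(u,w)`,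
the equation is minimal at `p` with multiplicative reduction, so `f_p = 1` and `p ∣ N`.
[cite: SilvermanAEC2009, VII.5 Prop. 5.1(b)] -/
theorem dvd_conductorNorm_of_prime {u w : ℤ} (huw : IsCoprime u w)
    [((⟨u ^ 2 + 2 * u * w - 19 * w ^ 2, 2 * w * (u - 5 * w) * (u - w) ^ 2,
        2 * w * (u - 5 * w) * (u - w) ^ 2 * (u - 3 * w) * (u + 3 * w), 0, 0⟩ :
        WeierstrassCurve ℤ).baseChange ℚ).IsElliptic]
    {p : ℕ} (hp : p.Prime) (h5 : 5 ≤ p)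
    (h : (p : ℤ) ∣ w * (u - w) * (u - 3 * w) * (u + 3 * w) * (u - 5 * w) * (u - 9 * w)) :
    p ∣ ((⟨u ^ 2 + 2 * u * w - 19 * w ^ 2, 2 * w * (u - 5 * w) * (u - w) ^ 2,
        2 * w * (u - 5 * w) * (u - w) ^ 2 * (u - 3 * w) * (u + 3 * w), 0, 0⟩ :
        WeierstrassCurve ℤ).baseChange ℚ).conductorNorm ℤ := by
  set W₀ : WeierstrassCurve ℤ := ⟨u ^ 2 + 2 * u * w - 19 * w ^ 2, 2 * w * (u - 5 * w) * (u - w) ^ 2,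
    2 * w * (u - 5 * w) * (u - w) ^ 2 * (u - 3 * w) * (u + 3 * w), 0, 0⟩ with hW₀
  obtain ⟨v, hv⟩ := exists_place ⟨p, hp⟩
  simp only at hv
  have hc₄ : ¬ (natGenerator v : ℤ) ∣ W₀.c₄ := by
    rw [hv]; exact not_dvd_c₄ huw hp h5 h
  have hΔ : (natGenerator v : ℤ) ∣ W₀.Δ := by
    rw [hv, hW₀, Δ_eq]
    exact h.trans (Dvd.intro (64 * (w ^ 5 * (u - w) ^ 5 * (u - 3 * w) * (u + 3 * w) * (u - 5 * w) ^ 5 *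
      (u - 9 * w))) (by ring))
  have hmin : (W₀.baseChange ℚ).IsMinimalAt v := isMinimalAt_baseChange_int_of_not_dvd_c₄ hc₄
  have hf : (W₀.baseChange ℚ).conductorExponent v = 1 :=
    conductorExponent_eq_one_of_dvd_Δ_of_not_dvd_c₄ hmin hΔ hc₄
  have hfac := factorization_conductorNorm_holds (W₀.baseChange ℚ) v
  rw [hv, hf] at hfac
  have hN : (W₀.baseChange ℚ).conductorNorm ℤ ≠ 0 := (conductorNorm_pos_holds (W₀.baseChange ℚ)).ne'
  exact (hp.dvd_iff_one_le_factorization hN).mpr hfac.ge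

/-- **The dictionary, conductor half**: for coprime `u, w` with `F(u,w) ≠ 0` and the Kubert equation
elliptic over `ℚ`, `rad F ∣ 6 · N` (primes `p ≥ 5` by `dvd_conductorNorm_of_prime`, `2, 3` by the
factor `6`). [cite: SilvermanAEC2009, VII.5 Prop. 5.1(b)] -/
theorem radical_natAbs_dvd_six_mul_conductorNorm {u w : ℤ} (huw : IsCoprime u w)
    (h0 : w * (u - w) * (u - 3 * w) * (u + 3 * w) * (u - 5 * w) * (u - 9 * w) ≠ 0)
    [((⟨u ^ 2 + 2 * u * w - 19 * w ^ 2, 2 * w * (u - 5 * w) * (u - w) ^ 2,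
        2 * w * (u - 5 * w) * (u - w) ^ 2 * (u - 3 * w) * (u + 3 * w), 0, 0⟩ :
        WeierstrassCurve ℤ).baseChange ℚ).IsElliptic] :
    (radical (w * (u - w) * (u - 3 * w) * (u + 3 * w) * (u - 5 * w) * (u - 9 * w))).natAbs ∣
      6 * ((⟨u ^ 2 + 2 * u * w - 19 * w ^ 2, 2 * w * (u - 5 * w) * (u - w) ^ 2,
        2 * w * (u - 5 * w) * (u - w) ^ 2 * (u - 3 * w) * (u + 3 * w), 0, 0⟩ :
        WeierstrassCurve ℤ).baseChange ℚ).conductorNorm ℤ := by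
  set m : ℤ := w * (u - w) * (u - 3 * w) * (u + 3 * w) * (u - 5 * w) * (u - 9 * w) with hm
  set N : ℕ := ((⟨u ^ 2 + 2 * u * w - 19 * w ^ 2, 2 * w * (u - 5 * w) * (u - w) ^ 2,
        2 * w * (u - 5 * w) * (u - w) ^ 2 * (u - 3 * w) * (u + 3 * w), 0, 0⟩ :
        WeierstrassCurve ℤ).baseChange ℚ).conductorNorm ℤ with hNdef
  have hm0 : m.natAbs ≠ 0 := Int.natAbs_ne_zero.mpr h0
  have hrad : (radical m).natAbs = radical m.natAbs := by
    rw [← Int.radical_natAbs_eq_radical, Int.natAbs_natCast]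
  rw [hrad]
  have hN : N ≠ 0 := (conductorNorm_pos_holds _).ne'
  have h6N : 6 * N ≠ 0 := mul_ne_zero (by norm_num) hN
  -- every prime of `m` divides `6 N`
  have key : ∀ p : ℕ, p.Prime → p ∣ m.natAbs → p ∣ 6 * N := by
    intro p hp hpm
    by_cases hp2 : p = 2
    · subst hp2; exact dvd_mul_of_dvd_left (by norm_num) _
    by_cases hp3 : p = 3
    · subst hp3; exact dvd_mul_of_dvd_left (by norm_num) _
    have h5 : 5 ≤ p := by
      have h2 := hp.two_le
      by_contra hlt
      interval_cases p <;> simp_all (config := {decide := true})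
    exact dvd_mul_of_dvd_right (dvd_conductorNorm_of_prime huw hp h5 (Int.natCast_dvd.mpr hpm)) 6
  -- hence the radical (product of the distinct primes of `m`) divides `6 N`
  rw [← Nat.factorization_le_iff_dvd radical_ne_zero h6N]
  intro p
  by_cases hp : p.Prime
  · rw [factorization_radical_apply hm0 hp]
    split_ifs with hpn
    · exact (hp.dvd_iff_one_le_factorization h6N).mp (key p hp hpn)
    · exact Nat.zero_le _
  · simp [Nat.factorization_eq_zero_of_not_prime _ hp]

/-- **The dictionary, discriminant half**: `|Δ_min(W)| ≤ |64 w⁶(u−w)⁶(u−3w)²(u+3w)²(u−5w)⁶(u−9w)²|`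
as real numbers for the Kubert equation elliptic over `ℚ` (the right-hand side is `|Δ|` of the
integral equation, and `Δ_min ∣ Δ(W₀)` prime by prime). [cite: SilvermanAEC2009, VII.1 Remark 1.1] -/
theorem cast_minimalDiscriminantNorm_le (u w : ℤ)
    [((⟨u ^ 2 + 2 * u * w - 19 * w ^ 2, 2 * w * (u - 5 * w) * (u - w) ^ 2,
        2 * w * (u - 5 * w) * (u - w) ^ 2 * (u - 3 * w) * (u + 3 * w), 0, 0⟩ :
        WeierstrassCurve ℤ).baseChange ℚ).IsElliptic] :
    ((((⟨u ^ 2 + 2 * u * w - 19 * w ^ 2, 2 * w * (u - 5 * w) * (u - w) ^ 2,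
        2 * w * (u - 5 * w) * (u - w) ^ 2 * (u - 3 * w) * (u + 3 * w), 0, 0⟩ :
        WeierstrassCurve ℤ).baseChange ℚ).minimalDiscriminantNorm ℤ : ℕ) : ℝ) ≤
      |(((64 * (w ^ 6 * (u - w) ^ 6 * (u - 3 * w) ^ 2 * (u + 3 * w) ^ 2 * (u - 5 * w) ^ 6 *
        (u - 9 * w) ^ 2) : ℤ)) : ℝ)| := by
  set W₀ : WeierstrassCurve ℤ := ⟨u ^ 2 + 2 * u * w - 19 * w ^ 2, 2 * w * (u - 5 * w) * (u - w) ^ 2,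
    2 * w * (u - 5 * w) * (u - w) ^ 2 * (u - 3 * w) * (u + 3 * w), 0, 0⟩ with hW₀
  have hΔ0 : W₀.Δ ≠ 0 := Δ_ne_zero_of_isElliptic_baseChange_int W₀
  -- `Δ_min ∣ Δ(W₀)` prime by prime (Silverman AEC VII.1 Remark 1.1)
  have hdvd : (W₀.baseChange ℚ).minimalDiscriminantNorm ℤ ∣ W₀.Δ.natAbs := by
    have hD0 : (W₀.baseChange ℚ).minimalDiscriminantNorm ℤ ≠ 0 :=
      (minimalDiscriminantNorm_pos_holds _).ne'
    rw [← Nat.factorization_le_iff_dvd hD0 (Int.natAbs_ne_zero.mpr hΔ0)]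
    intro p
    by_cases hp : p.Prime
    · obtain ⟨v, hv⟩ := exists_place ⟨p, hp⟩
      have hfac := factorization_minimalDiscriminantNorm_holds (W₀.baseChange ℚ) v
      obtain ⟨k, hk, -, -⟩ := exists_ordMinimalDiscriminant_add_eq_padicValInt v W₀
      haveI : Fact (natGenerator v).Prime := ⟨prime_natGenerator v⟩
      have hval : padicValInt (natGenerator v) W₀.Δ =
          W₀.Δ.natAbs.factorization (natGenerator v) := by
        rw [padicValInt, Nat.factorization_def _ (prime_natGenerator v)]
      simp only at hv
      rw [← hv, hfac, ← hval]
      omega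
    · simp [Nat.factorization_eq_zero_of_not_prime _ hp]
  have h1 : (W₀.baseChange ℚ).minimalDiscriminantNorm ℤ ≤ W₀.Δ.natAbs :=
    Nat.le_of_dvd (Int.natAbs_pos.mpr hΔ0) hdvd
  have h2 : ((W₀.Δ.natAbs : ℕ) : ℝ) =
      |(((64 * (w ^ 6 * (u - w) ^ 6 * (u - 3 * w) ^ 2 * (u + 3 * w) ^ 2 * (u - 5 * w) ^ 6 *
        (u - 9 * w) ^ 2) : ℤ)) : ℝ)| := by
    rw [Nat.cast_natAbs, Int.cast_abs, hW₀, Δ_eq]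
  rw [← h2]
  exact_mod_cast h1

/-- **The ℤ/2×ℤ/6 dictionary** (unfolded form of the route decl). [cite: SilvermanAEC2009, VII.1
Remark 1.1 and VII.5 Prop. 5.1(b)] -/
theorem twoSixDictionary (u w : ℤ) (huw : IsCoprime u w)
    (h0 : w * (u - w) * (u - 3 * w) * (u + 3 * w) * (u - 5 * w) * (u - 9 * w) ≠ 0)
    (W : WeierstrassCurve ℚ) [W.IsElliptic]
    (hW : W = ⟨((u ^ 2 + 2 * u * w - 19 * w ^ 2 : ℤ) : ℚ), ((2 * w * (u - 5 * w) * (u - w) ^ 2 : ℤ) : ℚ),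
      ((2 * w * (u - 5 * w) * (u - w) ^ 2 * (u - 3 * w) * (u + 3 * w) : ℤ) : ℚ), 0, 0⟩) :
    (W.minimalDiscriminantNorm ℤ : ℝ) ≤
        |(((64 * (w ^ 6 * (u - w) ^ 6 * (u - 3 * w) ^ 2 * (u + 3 * w) ^ 2 * (u - 5 * w) ^ 6 *
          (u - 9 * w) ^ 2) : ℤ)) : ℝ)| ∧
      (radical (w * (u - w) * (u - 3 * w) * (u + 3 * w) * (u - 5 * w) * (u - 9 * w))).natAbs ∣
        6 * W.conductorNorm ℤ := by
  have hW' : W = (⟨u ^ 2 + 2 * u * w - 19 * w ^ 2, 2 * w * (u - 5 * w) * (u - w) ^ 2,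
      2 * w * (u - 5 * w) * (u - w) ^ 2 * (u - 3 * w) * (u + 3 * w), 0, 0⟩ :
      WeierstrassCurve ℤ).baseChange ℚ :=
    hW.trans (baseChange_eq u w).symm
  subst hW'
  exact ⟨cast_minimalDiscriminantNorm_le u w, radical_natAbs_dvd_six_mul_conductorNorm huw h0⟩

end TwoSixDictionary

/-- **Closes stmt-ABC-24784 `TwoSixDictionary` of route `TwoSixPencil`**: Tate's algorithm away
from `6` on Kubert's ℤ/2×ℤ/6 model — `|Δ_min(W)| ≤ |64w⁶(u−w)⁶(u−3w)²(u+3w)²(u−5w)⁶(u−9w)²|` and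
`rad F ∣ 6·N_W` for coprime `u, w`. Library bookkeeping on a torsion class; NOT abc, NOT A-PS,
moves no rung. [cite: SilvermanAEC2009, VII.1 Remark 1.1 and VII.5 Prop. 5.1(b)] -/
theorem twoSixDictionary_proof : Summit.ABC.ABC.Theses.TwoSixPencil.TwoSixDictionary := by
  unfold Summit.ABC.ABC.Theses.TwoSixPencil.TwoSixDictionary
  intro u w huw h0 W _ hW
  exact TwoSixDictionary.twoSixDictionary u w huw h0 W hW

end Summit.ABC.ABC.Theorems
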